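import Literature.MathematicalPhysics.QuantumFieldTheory.Balaban1983to89.B6RandomWalkL2
import Literature.MathematicalPhysics.QuantumFieldTheory.Balaban1983to89.B6RandomWalkHom

/-!
# `Balaban1983to89.B6RandomWalkL2Hom` — T. Bałaban, *Propagators and renormalization transformations for lattice gauge theories. II*,
# Commun. Math. Phys. **96** (1984) 223–250 [Balaban1984PropagatorsII], (2.51)–(2.52) p. 232 and (2.140)–(2.141) p. 247 READ FOR OPERATORS BETWEEN TWO
# LATTICES in the `L²` norms: the block-`ℓ²` majorant calculus for HOMOMORPHISMS (`X`-functions → `Y`-functions, e.g. the averaging operators `Q′`,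
# `Q′*` between the fine lattice and the lattice of blocks 𝔅), the SITE END where `ℓ²` and sup coincide, and the «SANDWICH» `Q′*·L·Q′` of an operator on
# 𝔅 with scale-free entries — the `ℓ²` twin of `B6RandomWalkHom.HasMajorantHom` on the same carriers (first brick of the concrete layer of the
# kernel-free `ℓ²` route to the Sect.-B steps of [Balaban1985BackgroundPropagators] Theorem 3.3's operator, cell `pub-ymgap` N06 row 13)

statement-level skeleton of published theorems with citation tags; proofs where landed; nothing here is a claim about the Yang–Mills mass gap

WHAT IS PRINTED.  p. 232 [PDF 10]: *"|(Tλ)(x)| ≤ K(y, y′)|λ|, x ∈ B^j(y), supp λ ⊂ B^{j′}(y′) (2.51) … this property is preserved under the composition of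
operators possessing it … A summation preserves it also"*; p. 247 [PDF 25]: *"‖ζGJ‖, … ≤ O(1)[…]|ζ|e^{−δ₃d(y,y′)}‖J‖ (2.140) … and the series above is
convergent in the norms appearing in the inequalities (2.136)–(2.140)"*; [Balaban1985BackgroundPropagators] p. 399: *"For the operator P = I − R we obtain,
using again Lemma 2.1, … (3.49)"* with `R(U) = G′Q′*(Q′G′²Q′*)⁻¹Q′G′` ((3.25) p. 394) — the word through the lattice of blocks whose `L²` reading needs this
file — and (3.48) p. 398 (the kernel of `(Q′G′²Q′*)⁻¹` on 𝔅 with the factor `(L^{j′}η)^{−d}`, i.e. SCALE-FREE matrix entries, `B9Thm34Inv.ker`/`vol`).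

WHY THIS FILE (pub-ymgap N06 row 13, seat dag-n06-c g5; design memo `GSIDE-L2-SPEC.md` v2 of the seat).  The block-`ℓ²` calculus `B6RandomWalkL2` (p22) and
its users (`B9Ineq363L2`, `…Right`, `…Mixed`, `B9Ineq383L2`, `B9Ineq377L2`) live on ONE carrier; the (3.49)/(3.68) words of the non-local `P₁(A)` pass through the
lattice of blocks 𝔅 (`Q′ : X → 𝔅`, `(Q′G′²Q′*)⁻¹` on 𝔅, `Q′* : 𝔅 → X`).  On 𝔅 (one point per block) the `ℓ²` shape IS the sup shape; the only genuinely
`ℓ²` phenomenon is at the two averaging letters: `Q′*` costs `√#Δ(y)` and `Q′` gains `1/√#Δ(y′)`, so the sandwich carries the volume RATIO, absorbed by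
ONE scale transfer of the p. 398 remark («we may replace the factor (Lʲη)^α by (Lʲη)^β(L^{j′}η)^γ») — §3 packages exactly that.

WHAT IS PROVED (one `def` with body — `HasL2MajorantHom` —, theorems; 0 sorry; standard axioms).
* §1 **`HasL2MajorantHom blkX blkY T K`** (*"‖Δ(y)·Tu‖ ≤ K(y,y′)‖u‖ for supp u ⊂ Δ(y′)"* between two carriers), `hasL2MajorantHom_iff` (one carrier: IS
  `B6RandomWalkL2.HasL2Majorant`, `Iff.rfl`), `_mono`, `_add`, ★ `hasL2MajorantHom_comp` (*"preserved under the composition"*: 𝔅-convolution of the majorants, NO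
  volume factor).
* §2 the site end (`blkY = id` on 𝔅): `l2n_blockPiece_id` (`‖Δ(y)v‖ = |v(y)|`), `hasL2Majorant_sites_of_entry` (entrywise bound ⟹ block-`ℓ²` majorant on 𝔅),
  `hasL2MajorantHom_toSites_of_hasMajorantHom` (a sup Hom-majorant INTO 𝔅 is an `ℓ²` one: `sup ≤ ℓ²` on the source block).
* §3 ★★ `hasL2Majorant_sandwich` — `Q′* ∘ L ∘ Q′ ≺₂ κ_sκ_cBΛ·v(y)·e^{−(1−α)δd}` from `Q′ ≺₂ κ_c·w_c(y)𝟙` (Hom `X → 𝔅`), `L ≺₂ B·v(y)e^{−δd}` (on 𝔅), `Q′* ≺₂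
  κ_s·w_s(y)𝟙` (Hom `𝔅 → X`), the transfer `e^{−αδd(y,y′)}w_c(y′) ≦ Λw_c(y)` and `w_s·w_c ≦ 1` (at an instance: `w_c = (#Δ)^{−1/2}`, `w_s = (#Δ)^{1/2}`).

HONEST SCOPE.  Finite-dimensional bookkeeping; no operator of the papers appears; which letters of a frame satisfy the hypotheses is the instance's business;
count-neutral; NOT a node discharge; nothing continuum ∕ OS ∕ mass-gap ∕ Clay.  Cell `pub-ymgap` (HUMAN RULING D-0062), Track A node N06 [B9], N06-ASSIGNMENT
row 13, seat `pub-ymgap-dag-n06-c` (g5), 2026-08-27.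
-/

noncomputable section

open scoped BigOperators
open Finset

namespace Literature.MathematicalPhysics.QuantumFieldTheory.Balaban1983to89.B6RandomWalkL2Hom

open B6RandomWalk (BlockSupp HasMajorant blockPiece sum_blockPiece)
open B6RandomWalkHom (HasMajorantHom)
open B6RandomWalkL2 (l2n l2n_nonneg l2n_sq l2n_sum_le l2n_smul l2n_mono abs_apply_le_l2n blockPiece_sum blockPiece_off blockPiece_eq_self
  HasL2Majorant hasL2Majorant_mono)

variable {g : B6.Geometry} [DecidableEq g.Site] {X Y Z : Type} [Fintype X] [Fintype Y] [Fintype Z]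

/-! ## §1  Block-ℓ² majorants of homomorphisms between two carriers -/

section Hom

/-- THE BLOCK-`ℓ²` SHAPE OF (2.140) FOR AN OPERATOR BETWEEN TWO FUNCTION SPACES: *"‖Δ(y)·Tu‖ ≤ K(y, y′)‖u‖ for supp u ⊂ Δ(y′)"* — `T` maps functions on
the lattice `X` (blocks = fibres of `blkX`) to functions on the lattice `Y` (fibres of `blkY`; e.g. `X` = the fine carrier, `Y` = 𝔅, `T = Q′`) and has the
`L²` MAJORANT `K` on 𝔅 × 𝔅 (the `ℓ²` twin of `B6RandomWalkHom.HasMajorantHom`). [cite: Balaban1984PropagatorsII, (2.51) p.232 + (2.140)–(2.141) p.247] -/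
def HasL2MajorantHom (blkX : X → g.Site) (blkY : Y → g.Site) (T : (X → ℝ) →ₗ[ℝ] (Y → ℝ)) (K : g.Site → g.Site → ℝ) : Prop :=
  ∀ (y y' : g.Site) (u : X → ℝ), (∀ x, blkX x ≠ y' → u x = 0) → l2n (blockPiece blkY y (T u)) ≤ K y y' * l2n u

omit [DecidableEq g.Site] in
/-- For `X = Y` (one carrier, one block map) the two-space `L²` majorant IS `B6RandomWalkL2.HasL2Majorant`, by `Iff.rfl`.
[cite: Balaban1984PropagatorsII, (2.51) p.232 + (2.140) p.247 (bookkeeping, ours)] -/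
theorem hasL2MajorantHom_iff (blk : X → g.Site) (T : Module.End ℝ (X → ℝ)) (K : g.Site → g.Site → ℝ) :
    HasL2MajorantHom blk blk T K ↔ HasL2Majorant blk T K :=
  Iff.rfl

omit [DecidableEq g.Site] in
/-- monotonicity. [cite: Balaban1984PropagatorsII, (2.52) p.232 (bookkeeping, ours)] -/
theorem hasL2MajorantHom_mono (blkX : X → g.Site) (blkY : Y → g.Site) {T : (X → ℝ) →ₗ[ℝ] (Y → ℝ)} {K K' : g.Site → g.Site → ℝ}
    (h : HasL2MajorantHom blkX blkY T K) (hKK' : ∀ a b, K a b ≤ K' a b) : HasL2MajorantHom blkX blkY T K' :=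
  fun y y' u hu => (h y y' u hu).trans (mul_le_mul_of_nonneg_right (hKK' y y') (l2n_nonneg u))

omit [DecidableEq g.Site] in
/-- *"A summation preserves it also"*: `L²` Hom-majorants add. [cite: Balaban1984PropagatorsII, p.232 (after (2.52))] -/
theorem hasL2MajorantHom_add (blkX : X → g.Site) (blkY : Y → g.Site) {T₁ T₂ : (X → ℝ) →ₗ[ℝ] (Y → ℝ)} {K₁ K₂ : g.Site → g.Site → ℝ}
    (h₁ : HasL2MajorantHom blkX blkY T₁ K₁) (h₂ : HasL2MajorantHom blkX blkY T₂ K₂) :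
    HasL2MajorantHom blkX blkY (T₁ + T₂) (fun a b => K₁ a b + K₂ a b) := by
  intro y y' u hu
  rw [LinearMap.add_apply, B6RandomWalkL2.blockPiece_add, add_mul]
  exact (B6RandomWalkL2.l2n_add_le _ _).trans (add_le_add (h₁ y y' u hu) (h₂ y y' u hu))

omit [DecidableEq g.Site] in
/-- ★ **(2.52) ⇒ (2.55)ₐ IN `L²` BETWEEN CARRIERS** (*"preserved under the composition of operators possessing it"*): `T : X → Y` with `L²` majorant
`K_T`, `S : Y → Z` with `K_S ≧ 0` ⟹ `S ∘ T : X → Z` has the 𝔅-convolution `Σ_{y″}K_S(y,y″)K_T(y″,y′)` — insert `Σ_{y″}Δ(y″) = I` on `Y` and use the triangle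
inequality of `ℓ²` (NO volume factor), exactly as `B6RandomWalkL2.hasL2Majorant_mul`. [cite: Balaban1984PropagatorsII, (2.52)–(2.55) p.232 + (2.141) p.247] -/
theorem hasL2MajorantHom_comp (blkX : X → g.Site) (blkY : Y → g.Site) (blkZ : Z → g.Site)
    {T : (X → ℝ) →ₗ[ℝ] (Y → ℝ)} {S : (Y → ℝ) →ₗ[ℝ] (Z → ℝ)} {KT KS : g.Site → g.Site → ℝ}
    (hT : HasL2MajorantHom blkX blkY T KT) (hS : HasL2MajorantHom blkY blkZ S KS) (hKS : ∀ a b, 0 ≤ KS a b) :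
    HasL2MajorantHom blkX blkZ (S ∘ₗ T) (fun a b => ∑ y'' : g.Site, KS a y'' * KT y'' b) := by
  intro y y' u hu
  have hν : ∀ y'', l2n (blockPiece blkY y'' (T u)) ≤ KT y'' y' * l2n u := fun y'' => hT y'' y' u hu
  have hpiece : ∀ y'' : g.Site, l2n (blockPiece blkZ y (S (blockPiece blkY y'' (T u)))) ≤ KS y y'' * (KT y'' y' * l2n u) :=
    fun y'' => (hS y y'' _ (blockPiece_off blkY y'' (T u))).trans (mul_le_mul_of_nonneg_left (hν y'') (hKS _ _))
  have hdec : blockPiece blkZ y ((S ∘ₗ T) u) = ∑ y'' : g.Site, blockPiece blkZ y (S (blockPiece blkY y'' (T u))) := by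
    rw [LinearMap.comp_apply]
    conv_lhs => rw [← sum_blockPiece blkY (T u), map_sum]
    rw [blockPiece_sum]
  rw [hdec]
  refine (l2n_sum_le _ _).trans ?_
  rw [Finset.sum_mul]
  refine Finset.sum_le_sum fun y'' _ => ?_
  simpa [mul_assoc] using hpiece y''

end Hom

/-! ## §2  The site end: on the lattice of blocks 𝔅 (one point per block) the ℓ² shape is the sup shape -/

section Sites

omit [DecidableEq g.Site] in
/-- On 𝔅 with the identity block map, `‖Δ(y)v‖ = |v(y)|`. [cite: Balaban1984PropagatorsII, (2.52) p.232 (bookkeeping, ours)] -/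
theorem l2n_blockPiece_id (y : g.Site) (v : g.Site → ℝ) : l2n (blockPiece (fun z : g.Site => z) y v) = |v y| := by
  have hsq : l2n (blockPiece (fun z : g.Site => z) y v) ^ 2 = v y ^ 2 := by
    rw [l2n_sq, Finset.sum_eq_single y]
    · simp [blockPiece]
    · intro z _ hz
      simp [blockPiece, hz]
    · intro h; exact absurd (Finset.mem_univ y) h
  have h := congrArg Real.sqrt hsq
  rwa [Real.sqrt_sq (l2n_nonneg _), Real.sqrt_sq_eq_abs] at h

omit [DecidableEq g.Site] in
/-- a function on 𝔅 supported at `y′` has `ℓ²` size `|u(y′)|`. [cite: Balaban1984PropagatorsII, (2.52) p.232 (bookkeeping, ours)] -/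
theorem l2n_of_supported_site {y' : g.Site} {u : g.Site → ℝ} (hu : ∀ z, z ≠ y' → u z = 0) : l2n u = |u y'| := by
  have e : blockPiece (fun z : g.Site => z) y' u = u := blockPiece_eq_self (fun z : g.Site => z) hu
  rw [← l2n_blockPiece_id y' u, e]

/-- **ENTRYWISE BOUND ⟹ BLOCK-`ℓ²` MAJORANT ON 𝔅** (on the lattice of blocks the `ℓ²` shape (2.140) is the kernel shape (2.64)/(3.48) read entrywise): if
`|L(δ_{y′})(y)| ≦ K(y,y′)` for all `y, y′`, then `L ≺₂ K` for the identity block map. [cite: Balaban1984PropagatorsII, (2.51) p.232 + (2.140) p.247; Balaban1985BackgroundPropagators, (3.48) p.398] -/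
theorem hasL2Majorant_sites_of_entry {L : Module.End ℝ (g.Site → ℝ)} {K : g.Site → g.Site → ℝ}
    (h : ∀ y y' : g.Site, |L (Pi.single y' 1) y| ≤ K y y') :
    HasL2Majorant (fun z : g.Site => z) L K := by
  intro y y' u hu
  have hu' : u = u y' • (Pi.single y' (1 : ℝ) : g.Site → ℝ) := by
    funext z
    by_cases hz : z = y'
    · subst hz; simp
    · rw [hu z hz]; simp [Pi.single_eq_of_ne hz]
  have hLu : L u = u y' • L (Pi.single y' 1) := by
    conv_lhs => rw [hu']
    rw [map_smul]
  rw [l2n_blockPiece_id, l2n_of_supported_site hu, hLu, Pi.smul_apply, smul_eq_mul, abs_mul, mul_comm]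
  exact mul_le_mul_of_nonneg_right (h y y') (abs_nonneg _)

omit [DecidableEq g.Site] in
/-- **A SUP HOM-MAJORANT INTO 𝔅 IS AN `ℓ²` ONE** (`T : X → 𝔅`, e.g. `Q′`): `|(Tu)(y)| ≦ K(y,y′)·sup|u| ≦ K(y,y′)·‖u‖` since `sup ≦ ℓ²` on the source block
and `‖Δ(y)·Tu‖ = |(Tu)(y)|` on 𝔅. [cite: Balaban1984PropagatorsII, (2.51) p.232 + (2.140) p.247; Balaban1985BackgroundPropagators, (3.19) p.393] -/
theorem hasL2MajorantHom_toSites_of_hasMajorantHom (blkX : X → g.Site) {T : (X → ℝ) →ₗ[ℝ] (g.Site → ℝ)} {K : g.Site → g.Site → ℝ}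
    (h : HasMajorantHom blkX (fun z : g.Site => z) T K) :
    HasL2MajorantHom blkX (fun z : g.Site => z) T K := by
  intro y y' u hu
  have hBS : BlockSupp blkX u y' (l2n u) := ⟨l2n_nonneg u, fun x _ => abs_apply_le_l2n u x, hu⟩
  rw [l2n_blockPiece_id]
  exact h y' u (l2n u) hBS y

end Sites

/-! ## §3  The sandwich `Q′*·L·Q′` through 𝔅: scale-free entries of `L` and ONE volume-ratio transfer -/

section Sandwich

/-- ★★ **THE SANDWICH THROUGH THE LATTICE OF BLOCKS IN BLOCK-ℓ²** (the word `Q′*·(Q′G′²Q′*)⁻¹·Q′` of `R(U)`, (3.25), read in the `L²` norms of (3.46)):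
if the averaging letter `Q′ : X → 𝔅` has the diagonal `ℓ²` Hom-majorant `κ_c·w_c(y)𝟙[y = y′]`, the operator `L` on 𝔅 has `L ≺₂ B·v(y)·e^{−δd}` (on 𝔅 =
its entrywise bound, `hasL2Majorant_sites_of_entry`), the letter `Q′* : 𝔅 → X` has the diagonal `ℓ²` Hom-majorant `κ_s·w_s(y)𝟙[y = y′]`, and the weights
satisfy `w_s·w_c ≦ 1` and the p. 398 transfer `e^{−αδd(y,y′)}w_c(y′) ≦ Λ·w_c(y)`, then `Q′*∘L∘Q′ ≺₂ (κ_sκ_cBΛ)·v(y)·e^{−(1−α)δd}` — at an instance `w_c =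
(#Δ)^{−1/2}` (averaging gains), `w_s = (#Δ)^{1/2}` (spreading costs), and the transfer is the volume-ratio one.
[cite: Balaban1984PropagatorsII, (2.52)–(2.55) p.232 + (2.140)–(2.141) p.247; Balaban1985BackgroundPropagators, (3.25) p.394 + (3.48) p.398 + p.398 (remark after (3.47)) + (3.49) p.399; derivation ours] -/
theorem hasL2Majorant_sandwich (blkX : X → g.Site) (δ α Λ κc κs B : ℝ) (wc ws v : g.Site → ℝ)
    (hκc : 0 ≤ κc) (hκs : 0 ≤ κs) (hB : 0 ≤ B) (hΛ : 0 ≤ Λ) (hws : ∀ a, 0 ≤ ws a) (hv : ∀ a, 0 ≤ v a)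
    (hprod : ∀ a, ws a * wc a ≤ 1) (hT : ∀ a b : g.Site, Real.exp (-(α * δ * g.dist a b)) * wc b ≤ Λ * wc a)
    {Qc : (X → ℝ) →ₗ[ℝ] (g.Site → ℝ)} {L : Module.End ℝ (g.Site → ℝ)} {Qcs : (g.Site → ℝ) →ₗ[ℝ] (X → ℝ)}
    (hQc : HasL2MajorantHom blkX (fun z : g.Site => z) Qc (fun a b => if a = b then κc * wc a else 0))
    (hL : HasL2Majorant (fun z : g.Site => z) L (fun a b => B * v a * Real.exp (-(δ * g.dist a b))))
    (hQcs : HasL2MajorantHom (fun z : g.Site => z) blkX Qcs (fun a b => if a = b then κs * ws a else 0)) :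
    HasL2Majorant blkX (Qcs ∘ₗ L ∘ₗ Qc) (fun a b => (κs * κc * B * Λ) * v a * Real.exp (-((1 - α) * δ * g.dist a b))) := by
  -- L ∘ Q′ : X → 𝔅
  have hLQ : HasL2MajorantHom blkX (fun z : g.Site => z) (L ∘ₗ Qc)
      (fun a b => B * v a * Real.exp (-(δ * g.dist a b)) * (κc * wc b)) := by
    have h := hasL2MajorantHom_comp blkX (fun z : g.Site => z) (fun z : g.Site => z) (S := (L : (g.Site → ℝ) →ₗ[ℝ] (g.Site → ℝ)))
      hQc ((hasL2MajorantHom_iff _ _ _).mpr hL) (fun a b => by have := hv a; positivity)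
    refine hasL2MajorantHom_mono _ _ h fun a b => le_of_eq ?_
    rw [Finset.sum_eq_single b]
    · simp
    · intro y'' _ hne; simp [hne]
    · intro hb; exact absurd (Finset.mem_univ b) hb
  -- Q′* ∘ (L ∘ Q′) : X → X
  have hK : ∀ a b : g.Site, 0 ≤ (if a = b then κs * ws a else 0) := fun a b => by
    split_ifs
    · exact mul_nonneg hκs (hws a)
    · exact le_rfl
  have h3 := hasL2MajorantHom_comp blkX (fun z : g.Site => z) blkX hLQ hQcs hK
  have h3' : HasL2Majorant blkX (Qcs ∘ₗ L ∘ₗ Qc)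
      (fun a b => (κs * ws a) * (B * v a * Real.exp (-(δ * g.dist a b)) * (κc * wc b))) := by
    refine (hasL2MajorantHom_iff _ _ _).mp (hasL2MajorantHom_mono _ _ h3 fun a b => le_of_eq ?_)
    rw [Finset.sum_eq_single a]
    · simp
    · intro y'' _ hne; simp [Ne.symm hne]
    · intro ha; exact absurd (Finset.mem_univ a) ha
  refine hasL2Majorant_mono blkX h3' fun a b => ?_
  -- e^{−δd}·w_c(b) ≤ Λ·w_c(a)·e^{−(1−α)δd} and w_s(a)·w_c(a) ≤ 1
  have hsplit : Real.exp (-(δ * g.dist a b)) = Real.exp (-((1 - α) * δ * g.dist a b)) * Real.exp (-(α * δ * g.dist a b)) := by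
    rw [← Real.exp_add]; congr 1; ring
  have hE : 0 ≤ Real.exp (-((1 - α) * δ * g.dist a b)) := Real.exp_nonneg _
  have htr := hT a b
  calc κs * ws a * (B * v a * Real.exp (-(δ * g.dist a b)) * (κc * wc b))
      = (κs * κc * B * v a * Real.exp (-((1 - α) * δ * g.dist a b))) * (ws a * (Real.exp (-(α * δ * g.dist a b)) * wc b)) := by
        rw [hsplit]; ring
    _ ≤ (κs * κc * B * v a * Real.exp (-((1 - α) * δ * g.dist a b))) * (ws a * (Λ * wc a)) := by
        refine mul_le_mul_of_nonneg_left (mul_le_mul_of_nonneg_left htr (hws a)) ?_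
        have := hv a; positivity
    _ = (κs * κc * B * Λ) * v a * Real.exp (-((1 - α) * δ * g.dist a b)) * (ws a * wc a) := by ring
    _ ≤ (κs * κc * B * Λ) * v a * Real.exp (-((1 - α) * δ * g.dist a b)) * 1 := by
        refine mul_le_mul_of_nonneg_left (hprod a) ?_
        have := hv a; positivity
    _ = (κs * κc * B * Λ) * v a * Real.exp (-((1 - α) * δ * g.dist a b)) := by ring

end Sandwich

end Literature.MathematicalPhysics.QuantumFieldTheory.Balaban1983to89.B6RandomWalkL2Hom
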